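import Literature.Computability.AlgebraicComplexity.AlmanLi2026OneFunctionalSpeedup
import Literature.Computability.AlgebraicComplexity.AlmanLi2026CWGammaBound
import Literature.Computability.AlgebraicComplexity.AlmanLi2026AnalysisFacts
import Literature.Computability.AlgebraicComplexity.AsymptoticRankLeTwoThirdsOmega
import Literature.Computability.AlgebraicComplexity.LaserMethodValuesSym
import HarnessLib

/-!
# Thm. 7.1 of Alman–Li 2026: every `d × d × d` tensor has `R̃(T) ≤ sqrt(d^{4ω/3} + d^{2ω/3} − (d³−d²)^{ω/3}) < d^{2ω/3}`

Topic `Literature/Computability/AlgebraicComplexity` (family `MatrixMultiplication`). Source: J. Alman,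
B. Li, *Asymptotic Rank Speedup Theorems, Revisited*, arXiv:2605.21738 (2026), §7.2 "General
tensors", Thm. 7.1 with its proof (held text `paper:arxiv-2605.21738`, p0018 L18–70): "When `d ≥ 3`,
any `d × d × d` tensor `T` satisfies `R̃(T) ≤ sqrt(d^{4ω/3} + d^{2ω/3} − (d³−d²)^{ω/3}) < d^{2ω/3}`.
*Proof.* We start with the restriction `T^{⊗2} ≤ ⟨d,d²,d⟩`. … Let `f` be defined by
`f(z_{ki}) = [i = k]`. Then `(id ⊗ id ⊗ f)S = ∑_{i} ∑_{j} x_{ij} y_{ji}` is diagonal, hence has rank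
`s = d³`. Applying (prop:add_slice) and (prop:freelunch_oneslice), we obtain the degeneration
`T^{⊗2} ⊕ ⟨1,d³−d²,1⟩ ⊴ ⟨d,d²,d⟩ ⊕ ⟨1,d²,1⟩`. Passing to the asymptotic spectrum, this means
`φ(T)² ≤ d^{θ₁+2θ₂+θ₃} + d^{2θ₂} − (d³−d²)^{θ₂}`. … by permuting modes …
`φ(T)² ≤ d^{ϖ+θᵢ} + d^{2θᵢ} − (d³−d²)^{θᵢ}`. … there exists `i` such that `θᵢ ≤ ϖ/3`. … (lem:varpi)
… (lem:f_varpi_increasing) … `φ(T)² ≤ d^{4ω/3} + d^{2ω/3} − (d³−d²)^{ω/3}`. The claim then follows from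
Strassen duality."

## What is formalised (everything PROVED; no definitions, no named facts)

In the tree's coordinates the matrix multiplication tensor of the proof is
`S_d = ⟨d,1,d⟩ ⊠ ⟨d,d,1⟩` (`matMulTensor K d 1 d ⊠ matMulTensor K d d 1`, `≅ ⟨d²,d,d⟩`; its third
index family `(Fin 1 × Fin d) × (Fin d × Fin 1)` has size `d²` and carries the trace functional), and
`T ⊠ T ≤ S_d` is the Kronecker product of the tree's two generic reductions
`tensorRestrictsTo_matMulTensor_outer` / `_outer₃₁` (`AsymptoticRankLeTwoThirdsOmega`).

* `AlmanLi2026.thm71_contraction_rank` — "`(id ⊗ id ⊗ f)S` … has rank `d³`": the contraction is a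
  reindexed identity matrix.
* `AlmanLi2026.thm71_degeneration` — `S_d ⊕ ⟨d²-slice⟩ ⊵ T⊠T ⊕ ⟨(d³−d²)-slice⟩` for every
  `T : Fin d → Fin d → Fin d → K`, any field (slices with trivial factor third), by the tree's
  `AlmanLi2026.oneFunctional_speedup` (Props. 5.4 + 5.3 + Thm. 5.1) with `s = d²`
  (`rank (A ⊗ B ⊗ f)S ≤ d²` because that matrix has `d²` rows).
* `AlmanLi2026.thm71_spectral` — for a universal spectral point `φ` with exponents `θ`:
  `φ(T)² + (d³−d²)^{θᵢ} ≤ d^{ϖ+θᵢ} + (d²)^{θᵢ}` for `i = 0, 1, 2` (the three mode arrangements, by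
  rotating the degeneration of `rotate T`, `rotate² T`).
* **`AlmanLi2026.thm71`** — `R̃(T) ≤ sqrt(d^{4ω/3} + d^{2ω/3} − (d³−d²)^{ω/3})` for `d ≥ 3`, every
  field `K` (`ω = omega K`), via Lemma 9.1 / Lemma 9.2 (`AlmanLi2026AnalysisFacts`), Prop. 4.2
  (`2 ≤ ϖ ≤ ω ≤ 3`) and Strassen duality (`thm71_pointwise` is the bound at one spectral point);
  `AlmanLi2026.thm71_lt` — the printed `< d^{2ω/3}`; `thm71_of_card_le` — any index types of sizes
  `≤ d` (zero-padding).

## References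

* J. Alman, B. Li, *Asymptotic Rank Speedup Theorems, Revisited*, arXiv:2605.21738 (2026), Thm. 7.1
  (§7.2, p0018), Lemmas 9.1–9.2 (§9, p0025), Props. 4.1–4.2. [AlmanLi2026]
* M. Bläser, *Fast Matrix Multiplication*, ToC Graduate Surveys 5 (2013), Lemma 5.5 / Def. 7.2
  (permuting modes; relabelling restrictions). [Blaser2013]
-/

noncomputable section

open scoped BigOperators

namespace Literature.Computability.AlgebraicComplexity

namespace AlmanLi2026

section Rotations

variable {K : Type} [CommSemiring K] {ι κ μ ι' κ' μ' : Type}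

/-- `rotate (s ⊕ t) = rotate s ⊕ rotate t`. [folklore] -/
private theorem rotate_directSum₇ (s : ι → κ → μ → K) (t : ι' → κ' → μ' → K) :
    rotate (directSumTensor s t) = directSumTensor (rotate s) (rotate t) := by
  funext b c a
  rcases a with a | a <;> rcases b with b | b <;> rcases c with c | c <;> rfl

/-- `rotate (s ⊠ t) = rotate s ⊠ rotate t`. [folklore] -/
private theorem rotate_kronecker₇ (s : ι → κ → μ → K) (t : ι' → κ' → μ' → K) :
    rotate (kroneckerTensor s t) = kroneckerTensor (rotate s) (rotate t) := by
  funext b c a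
  simp [rotate_apply, kroneckerTensor_apply]

omit [CommSemiring K] in
/-- `rotate³ = id`. [folklore] -/
private theorem rotate_rotate_rotate₇ (t : ι → κ → μ → K) : rotate (rotate (rotate t)) = t := rfl

end Rotations

/-! ## The restriction `T ⊠ T ≤ ⟨d,1,d⟩ ⊠ ⟨d,d,1⟩` and the trace functional -/

section Degeneration

variable (K : Type) [Field K] (d : ℕ)

/-- "`(id ⊗ id ⊗ f)S = ∑ᵢ ∑ⱼ x_{ij} y_{ji}`" for the trace functional `f(z_{ki}) = [i = k]` on the
third index family of `⟨d,1,d⟩ ⊠ ⟨d,d,1⟩` (written inline as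
`fun c => if c.1.2 = c.2.1 then 1 else 0`): the entries of the contraction are those of a reindexed
identity matrix (first family `((i,j),(k,⋆)) ↦ ((i,⋆),(k,j))` second family).
[cite: AlmanLi2026, Thm. 7.1 (proof)] -/
theorem thm71_contraction_apply (a : (Fin d × Fin d) × (Fin d × Fin 1))
    (b : (Fin d × Fin 1) × (Fin d × Fin d)) :
    (∑ c, (fun c : (Fin 1 × Fin d) × (Fin d × Fin 1) => if c.1.2 = c.2.1 then (1 : K) else 0) c *
        kroneckerTensor (matMulTensor K d 1 d) (matMulTensor K d d 1) a b c) =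
      if ((a.1.1, a.2.2), (a.2.1, a.1.2)) = b then 1 else 0 := by
  classical
  obtain ⟨⟨a₁, a₂⟩, ⟨a₃, a₄⟩⟩ := a
  obtain ⟨⟨b₁, b₂⟩, ⟨b₃, b₄⟩⟩ := b
  have hb₂ : b₂ = 0 := Subsingleton.elim _ _
  have ha₄ : a₄ = 0 := Subsingleton.elim _ _
  subst hb₂; subst ha₄
  rw [Finset.sum_eq_single (((0 : Fin 1), a₂), (b₄, (0 : Fin 1)))]
  · simp only [kroneckerTensor_apply, matMulTensor, Prod.mk.injEq]
    by_cases h₁ : a₁ = b₁ <;> by_cases h₂ : a₃ = b₃ <;> by_cases h₃ : a₂ = b₄ <;> simp [h₁, h₂, h₃]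
  · rintro ⟨⟨c₁, c₂⟩, ⟨c₃, c₄⟩⟩ - hc
    have hc₁ : c₁ = 0 := Subsingleton.elim _ _
    have hc₄ : c₄ = 0 := Subsingleton.elim _ _
    subst hc₁; subst hc₄
    simp only [kroneckerTensor_apply, matMulTensor]
    by_cases h₂ : a₂ = c₂
    · by_cases h₃ : b₄ = c₃
      · subst h₂; subst h₃; exact absurd rfl hc
      · simp [h₃]
    · simp [h₂]
  · intro h; exact absurd (Finset.mem_univ _) h

/-- **"`(id ⊗ id ⊗ f)S` … has rank `s = d³`"** (here: `d·d·(d·1)`, the size of the first family):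
the contraction is the identity matrix reindexed along the bijection
`((i,j),(k,⋆)) ↦ ((i,⋆),(k,j))`. [cite: AlmanLi2026, Thm. 7.1 (proof)] -/
theorem thm71_contraction_rank :
    (Matrix.of fun a b =>
      ∑ c, (fun c : (Fin 1 × Fin d) × (Fin d × Fin 1) => if c.1.2 = c.2.1 then (1 : K) else 0) c *
        kroneckerTensor (matMulTensor K d 1 d) (matMulTensor K d d 1) a b c).rank =
      d * d * (d * 1) := by
  classical
  obtain ⟨e, he⟩ : ∃ e : (Fin d × Fin d) × (Fin d × Fin 1) ≃ (Fin d × Fin 1) × (Fin d × Fin d),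
      ∀ a, e a = ((a.1.1, a.2.2), (a.2.1, a.1.2)) :=
    ⟨{ toFun := fun a => ((a.1.1, a.2.2), (a.2.1, a.1.2))
       invFun := fun b => ((b.1.1, b.2.2), (b.2.1, b.1.2))
       left_inv := fun a => by simp
       right_inv := fun b => by simp }, fun a => rfl⟩
  have hM : (Matrix.of fun a b =>
      ∑ c, (fun c : (Fin 1 × Fin d) × (Fin d × Fin 1) => if c.1.2 = c.2.1 then (1 : K) else 0) c *
        kroneckerTensor (matMulTensor K d 1 d) (matMulTensor K d d 1) a b c) =
      (1 : Matrix ((Fin d × Fin 1) × (Fin d × Fin d)) ((Fin d × Fin 1) × (Fin d × Fin d)) K).submatrix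
        e (Equiv.refl _) := by
    ext a b
    rw [Matrix.of_apply, thm71_contraction_apply, Matrix.submatrix_apply, Matrix.one_apply, he]
    rfl
  rw [hM, Matrix.rank_submatrix, Matrix.rank_one]
  simp [Fintype.card_prod, Fintype.card_fin]
  ring

/-- **Alman–Li 2026, the degeneration of Thm. 7.1's proof**: for every `T : Fin d → Fin d → Fin d → K`
over a field, `⟨d,1,d⟩ ⊠ ⟨d,d,1⟩ ⊕ ⟨d²-slice⟩ ⊵ T ⊠ T ⊕ ⟨(d³−d²)-slice⟩` (printed:
`T^{⊗2} ⊕ ⟨1,d³−d²,1⟩ ⊴ ⟨d,d²,d⟩ ⊕ ⟨1,d²,1⟩`; slices with trivial factor third, `d³−d²` as the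
truncated `d·d·d − d·d`).  Proof as printed: `T ⊠ T ≤ S` (generic reductions, tensored), the trace
functional has a rank-`d³` contraction, `rank (A ⊗ B ⊗ f)S ≤ d²` (it has `d²` rows), Props. 5.4 + 5.3
+ Thm. 5.1 (`AlmanLi2026.oneFunctional_speedup`). [cite: AlmanLi2026, Thm. 7.1 (proof)] -/
theorem thm71_degeneration (T : Fin d → Fin d → Fin d → K) :
    AlgDegeneratesTo
      (directSumTensor (kroneckerTensor (matMulTensor K d 1 d) (matMulTensor K d d 1))
        (rotate (oneSliceTensor K (Fin (d * d)))))
      (directSumTensor (kroneckerTensor T T)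
        (rotate (oneSliceTensor K (Fin (d * d * d - d * d))))) := by
  classical
  -- `T ⊠ T ≤ ⟨d,1,d⟩ ⊠ ⟨d,d,1⟩`
  have hR : TensorRestrictsTo (kroneckerTensor (matMulTensor K d 1 d) (matMulTensor K d d 1))
      (kroneckerTensor T T) :=
    (tensorRestrictsTo_matMulTensor_outer T (Function.Embedding.refl _)
      (Function.Embedding.refl _)).kronecker
      (tensorRestrictsTo_matMulTensor_outer₃₁ T (Function.Embedding.refl _)
        (Function.Embedding.refl _))
  obtain ⟨A, B, C, hT⟩ := hR
  -- `rank (A ⊗ B ⊗ f)S ≤ d²` (number of rows)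
  have hs : (Matrix.of fun (a' b' : Fin d × Fin d) => ∑ a, ∑ b, ∑ c,
      A a' a * B b' b *
        (fun c : (Fin 1 × Fin d) × (Fin d × Fin 1) => if c.1.2 = c.2.1 then (1 : K) else 0) c *
        kroneckerTensor (matMulTensor K d 1 d) (matMulTensor K d d 1) a b c).rank ≤ d * d := by
    refine (Matrix.rank_le_card_height _).trans ?_
    simp [Fintype.card_prod, Fintype.card_fin]
  have h := oneFunctional_speedup hT
    (fun c : (Fin 1 × Fin d) × (Fin d × Fin 1) => if c.1.2 = c.2.1 then (1 : K) else 0) hs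
  rw [thm71_contraction_rank] at h
  refine h.trans_restrictsTo ((TensorRestrictsTo.refl _).directSum
    (tensorRestrictsTo_rotate_oneSliceTensor_of_le (K := K) ?_))
  simp only [Fintype.card_prod, Fintype.card_fin, Nat.mul_one]
  omega

end Degeneration

/-! ## The three spectral inequalities -/

section Spectral

variable {K : Type} [Field K] {F : SpectralMap K} (hF : IsUniversalSpectralPoint K F)
include hF

/-- `φ(rotate ⟨k,m,n⟩) = φ(⟨m,n,k⟩)` (mutual relabelling restrictions). [cite: Blaser2013, Lemma 5.5] -/
theorem map_rotate_matMulTensor (k m n : ℕ) :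
    F (rotate (matMulTensor K k m n)) = F (matMulTensor K m n k) :=
  le_antisymm (hF.mono _ _ (tensorRestrictsTo_matMulTensor_rotate' k m n))
    (hF.mono _ _ (tensorRestrictsTo_rotate_matMulTensor K k m n))

/-- `φ(rotate² ⟨k,m,n⟩) = φ(⟨n,k,m⟩)`. [cite: Blaser2013, Lemma 5.5] -/
theorem map_rotate_rotate_matMulTensor (k m n : ℕ) :
    F (rotate (rotate (matMulTensor K k m n))) = F (matMulTensor K n k m) := by
  have h₁ : F (rotate (rotate (matMulTensor K k m n))) = F (rotate (matMulTensor K m n k)) :=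
    le_antisymm
      (hF.mono _ _ (tensorRestrictsTo_rotate_modes (tensorRestrictsTo_matMulTensor_rotate' k m n)))
      (hF.mono _ _ (tensorRestrictsTo_rotate_modes (tensorRestrictsTo_rotate_matMulTensor K k m n)))
  rw [h₁, map_rotate_matMulTensor hF]

/-- `φ(rotate oneSlice(m)) = m^{θ₀}`, `φ(oneSlice(m)) = m^{θ₁}`, `φ(rotate² oneSlice(m)) = m^{θ₂}`
(`m ≥ 1`). [cite: AlmanLi2026, Proposition 4.1] -/
theorem map_oneSlice_directions {m : ℕ} (hm : 1 ≤ m) :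
    F (rotate (oneSliceTensor K (Fin m))) = (m : ℝ) ^ specMMPoint K F 0 ∧
    F (oneSliceTensor K (Fin m)) = (m : ℝ) ^ specMMPoint K F 1 ∧
    F (rotate (rotate (oneSliceTensor K (Fin m)))) = (m : ℝ) ^ specMMPoint K F 2 := by
  refine ⟨?_, ?_, ?_⟩
  · rw [← hF.map_matMulTensor_line₁ hm]
    exact le_antisymm (hF.mono _ _ (tensorRestrictsTo_matMul_rotate₁ m))
      (hF.mono _ _ (tensorRestrictsTo_rotate₁_matMul m))
  · rw [← hF.map_matMulTensor_line₂ hm]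
    exact le_antisymm
      (hF.mono _ _ (tensorRestrictsTo_matMulTensor_oneSliceTensor (Function.Embedding.refl _)))
      (hF.mono _ _ (tensorRestrictsTo_oneSliceTensor_matMulTensor (Equiv.refl _)))
  · rw [← hF.map_matMulTensor_line₃ hm]
    exact le_antisymm (hF.mono _ _ (tensorRestrictsTo_matMul_rotate₂ m))
      (hF.mono _ _ (tensorRestrictsTo_rotate₂_matMul m))

/-- **"Passing to the asymptotic spectrum … by permuting modes"**: for every universal spectral
point `φ` with exponents `θ = (θ₀,θ₁,θ₂)` and every `T : Fin d → Fin d → Fin d → K` (`d ≥ 2`),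
`φ(T)² + (d³−d²)^{θᵢ} ≤ d^{(θ₀+θ₁+θ₂)+θᵢ} + (d²)^{θᵢ}` for each `i`.
[cite: AlmanLi2026, Thm. 7.1 (proof: the displays with ϖ)] -/
theorem thm71_spectral {d : ℕ} (hd : 2 ≤ d) (T : Fin d → Fin d → Fin d → K) (i : Fin 3) :
    F T ^ 2 + ((d : ℝ) ^ 3 - (d : ℝ) ^ 2) ^ specMMPoint K F i ≤
      (d : ℝ) ^ ((∑ j, specMMPoint K F j) + specMMPoint K F i) +
        ((d : ℝ) ^ 2) ^ specMMPoint K F i := by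
  have hd1 : 1 ≤ d := by omega
  have hd0 : (0 : ℝ) < d := by exact_mod_cast (show 0 < d by omega)
  have hdd : 1 ≤ d * d := Nat.one_le_iff_ne_zero.2 (by positivity)
  have hle : d * d ≤ d * d * d := Nat.le_mul_of_pos_right _ (by omega)
  have ht : 1 ≤ d * d * d - d * d := by
    have : d * d * 2 ≤ d * d * d := Nat.mul_le_mul_left _ hd
    omega
  -- casts of the slice sizes
  have cs : ((d * d : ℕ) : ℝ) = (d : ℝ) ^ 2 := by push_cast; ring
  have ct : ((d * d * d - d * d : ℕ) : ℝ) = (d : ℝ) ^ 3 - (d : ℝ) ^ 2 := by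
    rw [Nat.cast_sub hle]; push_cast; ring
  -- `φ(S) = d^{θ₀} d^{θ₂} · d^{θ₀} d^{θ₁}` and its rotations
  have hS₀ : F (matMulTensor K d 1 d) = (d : ℝ) ^ specMMPoint K F 0 * (d : ℝ) ^ specMMPoint K F 2 := by
    rw [AlmanLi2026.prop41 hF hd1 le_rfl hd1]; simp
  have hS₁ : F (matMulTensor K d d 1) = (d : ℝ) ^ specMMPoint K F 0 * (d : ℝ) ^ specMMPoint K F 1 := by
    rw [AlmanLi2026.prop41 hF hd1 hd1 le_rfl]; simp
  have hS₂ : F (matMulTensor K 1 d d) = (d : ℝ) ^ specMMPoint K F 1 * (d : ℝ) ^ specMMPoint K F 2 := by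
    rw [AlmanLi2026.prop41 hF le_rfl hd1 hd1]; simp
  have hsum : (d : ℝ) ^ ((∑ j, specMMPoint K F j) + specMMPoint K F i) =
      (d : ℝ) ^ specMMPoint K F 0 * (d : ℝ) ^ specMMPoint K F 1 * (d : ℝ) ^ specMMPoint K F 2 *
        (d : ℝ) ^ specMMPoint K F i := by
    rw [Fin.sum_univ_three, Real.rpow_add hd0, Real.rpow_add hd0, Real.rpow_add hd0]
  rw [hsum]
  fin_cases i
  · -- direction `θ₀`: the degeneration of `T` as produced
    have hdeg := thm71_degeneration K d T
    have h := hF.mono_of_algDegeneratesTo hdeg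
    rw [hF.map_directSum, hF.map_directSum, hF.map_kronecker, hF.map_kronecker,
      (map_oneSlice_directions hF hdd).1, (map_oneSlice_directions hF ht).1, cs, ct, hS₀, hS₁] at h
    simp only [Fin.zero_eta, Fin.isValue]
    nlinarith [h]
  · -- direction `θ₁`: the degeneration of `rotate T`, rotated twice
    have hdeg := algDegeneratesTo_rotate_modes (algDegeneratesTo_rotate_modes
      (thm71_degeneration K d (rotate T)))
    simp only [rotate_directSum₇, rotate_kronecker₇, rotate_rotate_rotate₇] at hdeg
    have h := hF.mono_of_algDegeneratesTo hdeg
    rw [hF.map_directSum, hF.map_directSum, hF.map_kronecker, hF.map_kronecker,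
      (map_oneSlice_directions hF hdd).2.1, (map_oneSlice_directions hF ht).2.1, cs, ct,
      map_rotate_rotate_matMulTensor hF, map_rotate_rotate_matMulTensor hF, hS₁, hS₂] at h
    simp only [Fin.mk_one, Fin.isValue]
    nlinarith [h]
  · -- direction `θ₂`: the degeneration of `rotate² T`, rotated once
    have hdeg := algDegeneratesTo_rotate_modes (thm71_degeneration K d (rotate (rotate T)))
    simp only [rotate_directSum₇, rotate_kronecker₇, rotate_rotate_rotate₇] at hdeg
    have h := hF.mono_of_algDegeneratesTo hdeg
    rw [hF.map_directSum, hF.map_directSum, hF.map_kronecker, hF.map_kronecker,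
      (map_oneSlice_directions hF hdd).2.2, (map_oneSlice_directions hF ht).2.2, cs, ct,
      map_rotate_matMulTensor hF, map_rotate_matMulTensor hF, hS₂, hS₀] at h
    simp only [Fin.reduceFinMk, Fin.isValue]
    nlinarith [h]

end Spectral

/-! ## Thm. 7.1 -/

section Main

variable (K : Type) [Field K]

/-- **Thm. 7.1 at a spectral point** ("`φ(T)² ≤ d^{4ω/3} + d^{2ω/3} − (d³−d²)^{ω/3}`"): the three
spectral inequalities, `θᵢ ≤ ϖ/3` for the least exponent, Lemma 9.1 (`max` at `θ = ϖ/3`), Lemma 9.2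
(`F(ϖ/3)` increasing in `ϖ ∈ [2, ω]`, `ω ≤ 3`), `ϖ ≤ ω` (Prop. 4.2). [cite: AlmanLi2026, Thm. 7.1 (proof)] -/
theorem thm71_pointwise {F : SpectralMap K} (hF : IsUniversalSpectralPoint K F) {d : ℕ} (hd : 3 ≤ d)
    (T : Fin d → Fin d → Fin d → K) :
    F T ≤ Real.sqrt ((d : ℝ) ^ (4 * omega K / 3) + (d : ℝ) ^ (2 * omega K / 3)
      - ((d : ℝ) ^ 3 - (d : ℝ) ^ 2) ^ (omega K / 3)) := by
  have hT0 : 0 ≤ F T := hF.nonneg T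
  have hd3 : (3 : ℝ) ≤ d := by exact_mod_cast hd
  have hd0 : (0 : ℝ) < d := by linarith
  set θ := specMMPoint K F with hθdef
  set ϖ := ∑ j, θ j with hϖdef
  have hϖ2 : 2 ≤ ϖ := AlmanLi2026.prop42_two_le_sum hF
  have hϖω : ϖ ≤ omega K := AlmanLi2026.prop42_sum_le_omega hF
  have hω3 : omega K ≤ 3 := omega_le_three' K
  -- the least exponent `θ i₀ ≤ ϖ/3`
  obtain ⟨i₀, -, hi₀⟩ := Finset.exists_min_image Finset.univ θ Finset.univ_nonempty
  have hmin : θ i₀ ≤ ϖ / 3 := by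
    have h3 : 3 * θ i₀ ≤ ∑ j, θ j := by
      rw [Fin.sum_univ_three]
      linarith [hi₀ 0 (Finset.mem_univ _), hi₀ 1 (Finset.mem_univ _), hi₀ 2 (Finset.mem_univ _)]
    linarith
  have hθ0 : 0 ≤ θ i₀ := (AlmanLi2026.prop42_mem_Icc hF i₀).1
  -- the spectral inequality in that direction: `φ(T)² ≤ f(θ i₀)`
  have hspec := thm71_spectral hF (by omega) T i₀
  have e2 : ((d : ℝ) ^ 2) ^ θ i₀ = (d : ℝ) ^ (2 * θ i₀) := by
    rw [← Real.rpow_natCast, ← Real.rpow_mul hd0.le]; norm_num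
  rw [e2] at hspec
  -- Lemma 9.1 then Lemma 9.2
  have h91 := AlmanLi2026.lemma91_le hd3 hϖ2 hθ0 hmin
  have h92 := AlmanLi2026.lemma92_le hd3 hϖ2 hϖω hω3
  have e3 : (d : ℝ) ^ (ϖ + ϖ / 3) + (d : ℝ) ^ (2 * (ϖ / 3)) - ((d : ℝ) ^ 3 - (d : ℝ) ^ 2) ^ (ϖ / 3) =
      (d : ℝ) ^ (4 * ϖ / 3) + (d : ℝ) ^ (2 * ϖ / 3) - ((d : ℝ) ^ 3 - (d : ℝ) ^ 2) ^ (ϖ / 3) := by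
    rw [show ϖ + ϖ / 3 = 4 * ϖ / 3 by ring, show 2 * (ϖ / 3) = 2 * ϖ / 3 by ring]
  have hsq : F T ^ 2 ≤ (d : ℝ) ^ (4 * omega K / 3) + (d : ℝ) ^ (2 * omega K / 3)
      - ((d : ℝ) ^ 3 - (d : ℝ) ^ 2) ^ (omega K / 3) := by linarith
  exact (Real.le_sqrt hT0 ((sq_nonneg _).trans hsq)).2 hsq

/-- **Alman–Li 2026, Thm. 7.1**: for `d ≥ 3`, every tensor `T : Fin d → Fin d → Fin d → K` (any
field `K`, `ω = omega K`) satisfies `R̃(T) ≤ sqrt(d^{4ω/3} + d^{2ω/3} − (d³ − d²)^{ω/3})`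
(`thm71_pointwise` and Strassen duality). [cite: AlmanLi2026, Thm. 7.1] -/
theorem thm71 {d : ℕ} (hd : 3 ≤ d) (T : Fin d → Fin d → Fin d → K) :
    asymptoticRank T ≤ Real.sqrt ((d : ℝ) ^ (4 * omega K / 3) + (d : ℝ) ^ (2 * omega K / 3)
      - ((d : ℝ) ^ 3 - (d : ℝ) ^ 2) ^ (omega K / 3)) :=
  strassen_duality_asymptoticRank.asymptoticRank_le (strassen_duality_asymptoticRank_holds K) T
    fun _ hF => thm71_pointwise K hF hd T

/-- **Thm. 7.1 for any `d × d × d` format** (index types of sizes `≤ d`; "any `d × d × d` tensor"):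
zero-padding `T` into `Fin d × Fin d × Fin d` is a restriction, and spectral points are monotone.
[cite: AlmanLi2026, Thm. 7.1] -/
theorem thm71_of_card_le {ι κ μ : Type} [Fintype ι] [Fintype κ] [Fintype μ] (T : ι → κ → μ → K)
    {d : ℕ} (hd : 3 ≤ d) (hι : Fintype.card ι ≤ d) (hκ : Fintype.card κ ≤ d)
    (hμ : Fintype.card μ ≤ d) :
    asymptoticRank T ≤ Real.sqrt ((d : ℝ) ^ (4 * omega K / 3) + (d : ℝ) ^ (2 * omega K / 3)
      - ((d : ℝ) ^ 3 - (d : ℝ) ^ 2) ^ (omega K / 3)) := by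
  classical
  set eι : ι ↪ Fin d := (Fintype.equivFin ι).toEmbedding.trans (Fin.castLEEmb hι) with heι
  set eκ : κ ↪ Fin d := (Fintype.equivFin κ).toEmbedding.trans (Fin.castLEEmb hκ) with heκ
  set eμ : μ ↪ Fin d := (Fintype.equivFin μ).toEmbedding.trans (Fin.castLEEmb hμ) with heμ
  -- zero-padding of `T`
  set T' : Fin d → Fin d → Fin d → K := fun x y z =>
    ∑ a, if eι a = x then ∑ b, if eκ b = y then ∑ c, if eμ c = z then T a b c else 0 else 0 else 0
    with hT'
  have hTT' : (fun a b c => T' (eι a) (eκ b) (eμ c)) = T := by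
    funext a b c
    simp [hT', eι.injective.eq_iff, eκ.injective.eq_iff, eμ.injective.eq_iff, Finset.sum_ite_eq']
  have hres : TensorRestrictsTo T' T := by
    have h := tensorRestrictsTo_precomp T' eι eκ eμ
    rwa [hTT'] at h
  exact strassen_duality_asymptoticRank.asymptoticRank_le (strassen_duality_asymptoticRank_holds K) T
    fun F hF => (hF.mono _ _ hres).trans (thm71_pointwise K hF hd T')

/-- **Alman–Li 2026, Thm. 7.1, second inequality**: the bound is strictly below Strassen's
`d^{2ω/3}` (`d ≥ 3`: `d³ − d² > d²`). [cite: AlmanLi2026, Thm. 7.1] -/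
theorem thm71_lt {d : ℕ} (hd : 3 ≤ d) :
    Real.sqrt ((d : ℝ) ^ (4 * omega K / 3) + (d : ℝ) ^ (2 * omega K / 3)
      - ((d : ℝ) ^ 3 - (d : ℝ) ^ 2) ^ (omega K / 3)) < (d : ℝ) ^ (2 * omega K / 3) := by
  have hd3 : (3 : ℝ) ≤ d := by exact_mod_cast hd
  have hd0 : (0 : ℝ) < d := by linarith
  have hω0 : 0 < omega K / 3 := by linarith [omega_two_le K]
  have hpos : 0 < (d : ℝ) ^ (2 * omega K / 3) := Real.rpow_pos_of_pos hd0 _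
  rw [Real.sqrt_lt' hpos]
  have e4 : ((d : ℝ) ^ (2 * omega K / 3)) ^ 2 = (d : ℝ) ^ (4 * omega K / 3) := by
    rw [← Real.rpow_natCast, ← Real.rpow_mul hd0.le]; ring_nf
  have e2 : (d : ℝ) ^ (2 * omega K / 3) = ((d : ℝ) ^ 2) ^ (omega K / 3) := by
    rw [← Real.rpow_natCast, ← Real.rpow_mul hd0.le]; ring_nf
  rw [e4, e2]
  have hlt : ((d : ℝ) ^ 2) ^ (omega K / 3) < ((d : ℝ) ^ 3 - (d : ℝ) ^ 2) ^ (omega K / 3) :=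
    Real.rpow_lt_rpow (by positivity) (by nlinarith) hω0
  linarith

/-- **Thm. 7.1 as one statement**: `R̃(T) ≤ sqrt(d^{4ω/3} + d^{2ω/3} − (d³−d²)^{ω/3}) < d^{2ω/3}`
for every `d × d × d` tensor, `d ≥ 3`; compare the tree's `Strassen1988_asymptoticRank_le_rpow_fin`
(`R̃(T) ≤ d^{2ω/3}`, `AsymptoticRankLeTwoThirdsOmega`). [cite: AlmanLi2026, Thm. 7.1] -/
theorem thm71' {d : ℕ} (hd : 3 ≤ d) (T : Fin d → Fin d → Fin d → K) :
    asymptoticRank T ≤ Real.sqrt ((d : ℝ) ^ (4 * omega K / 3) + (d : ℝ) ^ (2 * omega K / 3)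
      - ((d : ℝ) ^ 3 - (d : ℝ) ^ 2) ^ (omega K / 3)) ∧
    Real.sqrt ((d : ℝ) ^ (4 * omega K / 3) + (d : ℝ) ^ (2 * omega K / 3)
      - ((d : ℝ) ^ 3 - (d : ℝ) ^ 2) ^ (omega K / 3)) < (d : ℝ) ^ (2 * omega K / 3) :=
  ⟨thm71 K hd T, thm71_lt K hd⟩

end Main

end AlmanLi2026

end Literature.Computability.AlgebraicComplexity
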